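import Mathlib.Analysis.Calculus.Deriv.Inv
import Literature.NumberTheory.Transcendental.KZCubicalCalculus
import Literature.ModelTheory.ExponentialFields.SemialgebraicInterior
import HarnessLib

/-!
# Regular rational functions on the closed unit cube (vocabulary)

Definition file, companion of the cubical sub-calculus `KZCubicalCalculus.lean` of the
Kontsevich–Zagier calculus of moves (`KZCalculus.lean`), written for the corner identities of the crux
`PentagonInKZ` (route KontsevichZagierPeriods/FurushoPentagon, line `logfree-gauge-corner-flatness`)
but stated in general.  After the substitution `tᵢ = b·x₀⋯xᵢ` every absolutely convergent scaled
iterated integral `∫_{b > t₀ > ⋯ > t_{n-1} > 0} ∏ dtᵢ/(tᵢ − πᵢ)` is the integral over the closed unit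
cube `[0,1]ⁿ` of a REGULAR RATIONAL FUNCTION — a ratio of `ℚ`-polynomials whose denominator does
not vanish on the cube — so that Ayoub's presentation of effective periods by the cube
[Ayoub 2014, Def. 9–10] applies literally: such a function is real-analytic near the cube
(`Literature.ModelTheory.ExponentialFields.analyticOnNhd_aeval`, `AnalyticAt.div`) and
`ℚ`-semialgebraic on it, i.e. its representation `[[0,1]^M, num/den]` is a TAME CUBE
(`KZ.IntegralRep.tameCube`, `KZ.IntegralRep.IsTameCube`).

* `KZ.RFun M` — a regular rational function on `KZ.cube M`: fields `num den : MvPolynomial (Fin M) ℚ`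
  and `den_ne : ∀ x ∈ KZ.cube M, aeval x den ≠ 0`; `RFun.fn` its function, `RFun.rep` its tame cube
  representation [Kontsevich–Zagier 2001, §1.1; Ayoub 2014, Def. 10];
* algebra: `RFun.poly`, `RFun.const`, `RFun.add`, `RFun.neg`, `RFun.sub`, `RFun.mul` with their value
  lemmas on the cube;
* the data of Ayoub's Stokes relation `∂f/∂zᵢ − f|_{zᵢ=1} + f|_{zᵢ=0}` [Ayoub 2014, Def. 10]:
  `RFun.dlast` / `RFun.pd i` (quotient rule, `MvPolynomial.pderiv`), `RFun.face c` / `RFun.faceAt i c`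
  (substitution of a rational height `c ∈ [0,1]`, `MvPolynomial.bind₁` along `RFun.faceSubst`),
  `RFun.toLast i` (the coordinate permutation moving `i` to the last slot in `insertNth` order);
* relabelling `RFun.rename`, ignoring variables `RFun.lift` / `RFun.liftN`, the Fubini tensor
  `RFun.tensor` (`(T ⊗ S)(z) = T(z|_M) S(z|^N)`) [Kontsevich–Zagier 2001, §4.1], substitution
  `RFun.subst` along cube-preserving polynomial maps;
* `RFun.chi χ T = χ [[0,1]^M, T]` — the value of the cube representation under an additive map
  `χ : KZ.FormalRep →+ R` (a realisation of the rules).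

Also three real one-variable calculus lemmas for `aeval` along a coordinate (chain rule by
induction on the polynomial; the tree's `CurvePeriods.hasDerivAt_eval_comp` is the complex model).
The MOVES (`[T+S] ≡ [T]+[S]`, Stokes `[∂ᵢT] ≡ [T|₁] − [T|₀]`, relabelling, lifting, `[T]·[S] ≡ [T⊗S]`)
are theorems of the companion file `KZCubeRationalMoves.lean`.  No named facts are introduced.

## References

* M. Kontsevich, D. Zagier, *Periods* (2001), §1.1–1.2, §4.1. [cite: KontsevichZagier2001, §1.2]
* J. Ayoub, *Periods and the conjectures of Grothendieck and Kontsevich–Zagier*, EMS Newsletter 91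
  (2014), §2.2, Def. 9–10, Rem. 13. [cite: Ayoub2014, Def. 10]
* J. Bochnak, M. Coste, M.-F. Roy, *Real Algebraic Geometry* (1998), §2.2. [cite: BochnakCosteRoy1998, §2.2]
-/

noncomputable section

open _root_.MeasureTheory _root_.Set MvPolynomial
open Literature.ModelTheory.ExponentialFields (IsSemialgebraic analyticOnNhd_aeval continuous_aeval_real)

namespace Literature.NumberTheory.Transcendental.KZ

variable {M N : ℕ}

/-! ## Calculus helpers -/

/-- Chain rule for `aeval` of a rational-coefficient polynomial along a real path. [folklore] -/
theorem hasDerivAt_aeval_comp_real {γ : ℝ → (Fin N → ℝ)} {γ' : Fin N → ℝ} {t : ℝ}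
    (hγ : ∀ i, HasDerivAt (fun u => γ u i) (γ' i) t) (P : MvPolynomial (Fin N) ℚ) :
    HasDerivAt (fun u => aeval (γ u) P) (∑ i, aeval (γ t) (pderiv i P) * γ' i) t := by
  induction P using MvPolynomial.induction_on with
  | C a =>
    simp only [aeval_C, pderiv_C, map_zero, zero_mul, Finset.sum_const_zero]
    exact hasDerivAt_const t _
  | add p q hp hq =>
    have h := hp.add hq
    simp only [map_add, add_mul, Finset.sum_add_distrib]
    exact h
  | mul_X p i hp =>
    have h := hp.mul (hγ i)
    have key : ∀ k, aeval (γ t) (pderiv k (p * X i)) * γ' k =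
        aeval (γ t) (pderiv k p) * γ' k * γ t i +
          (if k = i then aeval (γ t) p * γ' i else 0) := by
      intro k
      rw [pderiv_mul, map_add, map_mul, map_mul, aeval_X]
      by_cases hk : k = i
      · subst hk
        rw [pderiv_X_self, map_one, if_pos rfl]
        ring
      · rw [pderiv_X_of_ne (fun h => hk h.symm), map_zero, if_neg hk]
        ring
    have hsum : (∑ k, aeval (γ t) (pderiv k (p * X i)) * γ' k) =
        (∑ k, aeval (γ t) (pderiv k p) * γ' k) * γ t i + aeval (γ t) p * γ' i := by
      rw [Finset.sum_congr rfl fun k _ => key k, Finset.sum_add_distrib, Finset.sum_mul,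
        Finset.sum_ite_eq' Finset.univ i, if_pos (Finset.mem_univ _)]
    rw [hsum]
    have hfun : (fun u => aeval (γ u) (p * X i)) = fun u => aeval (γ u) p * γ u i := by
      funext u
      rw [map_mul, aeval_X]
    rw [hfun]
    exact h

/-- Derivative of a polynomial along one coordinate: `d/dx P(z[i := x]) = (∂ᵢP)(z[i := x])`.
[folklore] -/
theorem hasDerivAt_aeval_update (P : MvPolynomial (Fin N) ℚ) (z : Fin N → ℝ) (i : Fin N) (x₀ : ℝ) :
    HasDerivAt (fun x => aeval (Function.update z i x) P)
      (aeval (Function.update z i x₀) (pderiv i P)) x₀ := by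
  have hγ : ∀ k, HasDerivAt (fun u => Function.update z i u k) (if k = i then 1 else 0) x₀ := by
    intro k
    by_cases hk : k = i
    · subst hk
      simp only [Function.update_self, if_true]
      exact hasDerivAt_id x₀
    · simp only [Function.update_of_ne hk, if_neg hk]
      exact hasDerivAt_const x₀ _
  have h := hasDerivAt_aeval_comp_real hγ P
  simp only [mul_ite, mul_one, mul_zero, Finset.sum_ite_eq', Finset.mem_univ, if_true] at h
  exact h

/-- Quotient rule along one coordinate for a ratio of polynomials. [folklore] -/
theorem hasDerivAt_aeval_div_aeval_update (P Q : MvPolynomial (Fin N) ℚ) (z : Fin N → ℝ) (i : Fin N)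
    (x₀ : ℝ) (hQ : aeval (Function.update z i x₀) Q ≠ 0) :
    HasDerivAt (fun x => aeval (Function.update z i x) P / aeval (Function.update z i x) Q)
      ((aeval (Function.update z i x₀) (pderiv i P) * aeval (Function.update z i x₀) Q -
          aeval (Function.update z i x₀) P * aeval (Function.update z i x₀) (pderiv i Q)) /
        (aeval (Function.update z i x₀) Q) ^ 2) x₀ :=
  (hasDerivAt_aeval_update P z i x₀).div (hasDerivAt_aeval_update Q z i x₀) hQ

/-! ## Regular rational functions on the closed cube -/

/-- A REGULAR RATIONAL FUNCTION on the closed unit cube `[0,1]^M`: a ratio of `ℚ`-polynomials whose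
denominator does not vanish on the cube. [cite: KontsevichZagier2001, §1.1] -/
structure RFun (M : ℕ) where
  /-- numerator -/
  num : MvPolynomial (Fin M) ℚ
  /-- denominator -/
  den : MvPolynomial (Fin M) ℚ
  /-- the denominator does not vanish on the closed cube -/
  den_ne : ∀ x ∈ KZ.cube M, aeval x den ≠ 0

namespace RFun

variable (T S : RFun M)

/-- The function of a regular rational function. [folklore] -/
def fn (x : Fin M → ℝ) : ℝ := aeval x T.num / aeval x T.den

/-- Unfolding `fn`. [folklore] -/
theorem fn_apply (x : Fin M → ℝ) : T.fn x = aeval x T.num / aeval x T.den := rfl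

/-- A regular rational function is real-analytic near the closed cube. [folklore] -/
theorem analyticOnNhd_fn : AnalyticOnNhd ℝ T.fn (KZ.cube M) := fun x hx =>
  ((analyticOnNhd_aeval T.num) x (mem_univ _)).div ((analyticOnNhd_aeval T.den) x (mem_univ _))
    (T.den_ne x hx)

/-- A regular rational function is `ℚ`-semialgebraic on the closed cube. [cite: BochnakCosteRoy1998, §2.2] -/
theorem isSemialgebraicFunOn_fn : IsSemialgebraicFunOn ℚ (KZ.cube M) T.fn :=
  isSemialgebraicFunOn_aeval_div_aeval KZ.isSemialgebraic_cube T.num T.den T.den_ne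

/-- **The tame cube representation `[[0,1]^M, T]` of a regular rational function.**
[cite: KontsevichZagier2001, §1.1] -/
def rep : KZ.IntegralRep M := KZ.IntegralRep.tameCube T.fn T.analyticOnNhd_fn T.isSemialgebraicFunOn_fn

/-- The domain of the representation. [folklore] -/
@[simp] theorem rep_domain : T.rep.domain = KZ.cube M := rfl

/-- The integrand of the representation. [folklore] -/
@[simp] theorem rep_integrand : T.rep.integrand = T.fn := rfl

/-- The representation is a tame cube. [folklore] -/
theorem isTameCube_rep : T.rep.IsTameCube := KZ.IntegralRep.isTameCube_tameCube _ _ _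

/-! ### Algebra -/

/-- A polynomial as a regular rational function. [folklore] -/
def poly (P : MvPolynomial (Fin M) ℚ) : RFun M := ⟨P, 1, fun x _ => by simp⟩

/-- A rational constant. [folklore] -/
def const (c : ℚ) : RFun M := poly (C c)

/-- Sum. [folklore] -/
def add : RFun M :=
  ⟨T.num * S.den + S.num * T.den, T.den * S.den, fun x hx => by
    rw [map_mul]; exact mul_ne_zero (T.den_ne x hx) (S.den_ne x hx)⟩

/-- Negation. [folklore] -/
def neg : RFun M := ⟨-T.num, T.den, T.den_ne⟩

/-- Difference. [folklore] -/
def sub : RFun M := T.add S.neg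

/-- Product (same variables). [folklore] -/
def mul : RFun M :=
  ⟨T.num * S.num, T.den * S.den, fun x hx => by
    rw [map_mul]; exact mul_ne_zero (T.den_ne x hx) (S.den_ne x hx)⟩

variable {T S}

/-- Value of `poly`. [folklore] -/
@[simp] theorem fn_poly (P : MvPolynomial (Fin M) ℚ) (x : Fin M → ℝ) : (poly P).fn x = aeval x P := by
  simp [poly, fn]

/-- Value of `const`. [folklore] -/
@[simp] theorem fn_const (c : ℚ) (x : Fin M → ℝ) : (const c : RFun M).fn x = c := by
  simp [const]

/-- Value of a sum on the cube. [folklore] -/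
theorem fn_add {x : Fin M → ℝ} (hx : x ∈ KZ.cube M) : (T.add S).fn x = T.fn x + S.fn x := by
  simp only [fn, add, map_add, map_mul]
  field_simp [T.den_ne x hx, S.den_ne x hx]

/-- Value of a negation. [folklore] -/
@[simp] theorem fn_neg (x : Fin M → ℝ) : T.neg.fn x = -T.fn x := by
  simp only [fn, neg, map_neg, neg_div]

/-- Value of a difference on the cube. [folklore] -/
theorem fn_sub {x : Fin M → ℝ} (hx : x ∈ KZ.cube M) : (T.sub S).fn x = T.fn x - S.fn x := by
  rw [sub, fn_add hx, fn_neg, sub_eq_add_neg]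

/-- Value of a product. [folklore] -/
theorem fn_mul (x : Fin M → ℝ) : (T.mul S).fn x = T.fn x * S.fn x := by
  simp only [fn, mul, map_mul]
  rw [div_mul_div_comm]

/-! ### The Stokes move along the last coordinate -/

/-- The derivative along the last coordinate (quotient rule). [folklore] -/
def dlast (T : RFun (M + 1)) : RFun (M + 1) :=
  ⟨pderiv (Fin.last M) T.num * T.den - T.num * pderiv (Fin.last M) T.den, T.den ^ 2, fun x hx => by
    rw [map_pow]; exact pow_ne_zero 2 (T.den_ne x hx)⟩

/-- The substitution of the rational constant `c` for the last variable. [folklore] -/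
def faceSubst (M : ℕ) (c : ℚ) : Fin (M + 1) → MvPolynomial (Fin M) ℚ :=
  Fin.lastCases (C c) fun i => X i

/-- Evaluating the face substitution. [folklore] -/
theorem aeval_faceSubst (c : ℚ) (x : Fin M → ℝ) :
    (fun k => aeval x (faceSubst M c k)) = (Fin.snoc x (c : ℝ) : Fin (M + 1) → ℝ) := by
  funext k
  induction k using Fin.lastCases with
  | last => simp [faceSubst]
  | cast i => simp [faceSubst]

/-- The face `T(·, c)` of a regular rational function at a rational height `c ∈ [0,1]`. [folklore] -/
def face (T : RFun (M + 1)) (c : ℚ) (hc : 0 ≤ c ∧ c ≤ 1) : RFun M :=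
  ⟨bind₁ (faceSubst M c) T.num, bind₁ (faceSubst M c) T.den, fun x hx => by
    rw [aeval_bind₁, aeval_faceSubst]
    refine T.den_ne _ (KZ.snoc_mem_cube_iff.2 ⟨hx, ?_, ?_⟩) <;> exact_mod_cast (by tauto)⟩

/-- Value of a face. [folklore] -/
theorem fn_face (T : RFun (M + 1)) (c : ℚ) (hc : 0 ≤ c ∧ c ≤ 1) (x : Fin M → ℝ) :
    (T.face c hc).fn x = T.fn (Fin.snoc x (c : ℝ)) := by
  simp only [fn, face, aeval_bind₁, aeval_faceSubst]

/-! ### Coordinate permutations and ignoring a variable -/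

/-- Relabelling the variables along an equivalence. [folklore] -/
def rename (T : RFun M) (e : Fin M ≃ Fin N) : RFun N :=
  ⟨MvPolynomial.rename e T.num, MvPolynomial.rename e T.den, fun y hy => by
    rw [aeval_rename]; exact T.den_ne _ fun i => hy (e i)⟩

/-- Value of a relabelled function. [folklore] -/
theorem fn_rename (T : RFun M) (e : Fin M ≃ Fin N) (y : Fin N → ℝ) : (T.rename e).fn y = T.fn (y ∘ e) := by
  simp only [fn, rename, aeval_rename]

/-- Reading a function of `M` variables as a function of `M + 1` variables (ignoring the last one).
[folklore] -/
def lift (T : RFun M) : RFun (M + 1) :=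
  ⟨MvPolynomial.rename Fin.castSucc T.num, MvPolynomial.rename Fin.castSucc T.den, fun y hy => by
    rw [aeval_rename]; exact T.den_ne _ fun i => hy (Fin.castSucc i)⟩

/-- Value of a lift. [folklore] -/
theorem fn_lift (T : RFun M) (y : Fin (M + 1) → ℝ) : T.lift.fn y = T.fn (Fin.init y) := by
  simp only [fn, lift, aeval_rename]; rfl

/-- Value of a lift at a `snoc` point. [folklore] -/
theorem fn_lift_snoc (T : RFun M) (x : Fin M → ℝ) (t : ℝ) : T.lift.fn (Fin.snoc x t) = T.fn x := by
  rw [fn_lift, Fin.init_snoc]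

/-! ### The Fubini product -/

/-- The tensor product `(T ⊗ S)(z) = T(z|_M) · S(z|^N)` on the cube `[0,1]^{M+N}`. [folklore] -/
def tensor (T : RFun M) (S : RFun N) : RFun (M + N) :=
  ⟨MvPolynomial.rename (Fin.castAdd N) T.num * MvPolynomial.rename (Fin.natAdd M) S.num,
   MvPolynomial.rename (Fin.castAdd N) T.den * MvPolynomial.rename (Fin.natAdd M) S.den, fun z hz => by
    rw [map_mul, aeval_rename, aeval_rename]
    exact mul_ne_zero (T.den_ne _ fun i => hz _) (S.den_ne _ fun j => hz _)⟩

/-- Value of a tensor product. [folklore] -/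
theorem fn_tensor (T : RFun M) (S : RFun N) (z : Fin (M + N) → ℝ) :
    (T.tensor S).fn z = T.fn (fun i => z (Fin.castAdd N i)) * S.fn (fun j => z (Fin.natAdd M j)) := by
  simp only [fn, tensor, map_mul, aeval_rename, div_mul_div_comm]; rfl

/-! ### Partial derivatives and Stokes along any coordinate -/

/-- The partial derivative along the coordinate `i` (quotient rule). [folklore] -/
def pd (i : Fin M) (T : RFun M) : RFun M :=
  ⟨pderiv i T.num * T.den - T.num * pderiv i T.den, T.den ^ 2, fun x hx => by
    rw [map_pow]; exact pow_ne_zero 2 (T.den_ne x hx)⟩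

/-- The partial derivative along the last coordinate is `dlast`. [folklore] -/
theorem pd_last (T : RFun (M + 1)) : T.pd (Fin.last M) = T.dlast := rfl

/-- The coordinate permutation moving `i` to the last slot and keeping the order of the others.
[folklore] -/
def toLast (i : Fin (M + 1)) : Fin (M + 1) ≃ Fin (M + 1) := (finSuccEquiv' i).trans finSuccEquivLast.symm

/-- `toLast i i = last`. [folklore] -/
@[simp] theorem toLast_self (i : Fin (M + 1)) : toLast i i = Fin.last M := by
  simp [toLast, finSuccEquiv'_at]

/-- `toLast i (i.succAbove k) = castSucc k`. [folklore] -/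
@[simp] theorem toLast_succAbove (i : Fin (M + 1)) (k : Fin M) : toLast i (i.succAbove k) = Fin.castSucc k := by
  simp [toLast, finSuccEquiv'_succAbove, finSuccEquivLast_symm_some]

/-- Reading a `snoc` point along `toLast i` gives the `insertNth` point. [folklore] -/
theorem snoc_comp_toLast (i : Fin (M + 1)) (x : Fin M → ℝ) (c : ℝ) :
    ((Fin.snoc x c : Fin (M + 1) → ℝ) ∘ toLast i) = Fin.insertNth i c x := by
  funext k
  induction k using Fin.succAboveCases i with
  | x => simp [Fin.insertNth_apply_same]
  | p k => simp [Fin.insertNth_apply_succAbove]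

/-- The face `T(x with xᵢ := c)` at a rational height `c ∈ [0,1]`, as a function of the remaining
variables in their order. [folklore] -/
def faceAt (i : Fin (M + 1)) (T : RFun (M + 1)) (c : ℚ) (hc : 0 ≤ c ∧ c ≤ 1) : RFun M :=
  (T.rename (toLast i)).face c hc

/-- Value of a face along `i`. [folklore] -/
theorem fn_faceAt (i : Fin (M + 1)) (T : RFun (M + 1)) (c : ℚ) (hc : 0 ≤ c ∧ c ≤ 1) (x : Fin M → ℝ) :
    (T.faceAt i c hc).fn x = T.fn (Fin.insertNth i (c : ℝ) x) := by
  rw [faceAt, fn_face, fn_rename, snoc_comp_toLast]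

/-! ### Lifting to more variables and substitution -/

/-- Reading a function of `M` variables as a function of `M + n` variables (the first `M`).
[folklore] -/
def liftN (T : RFun M) (n : ℕ) : RFun (M + n) :=
  ⟨MvPolynomial.rename (Fin.castAdd n) T.num, MvPolynomial.rename (Fin.castAdd n) T.den, fun z hz => by
    rw [aeval_rename]; exact T.den_ne _ fun i => hz _⟩

/-- Value of `liftN`. [folklore] -/
theorem fn_liftN (T : RFun M) (n : ℕ) (z : Fin (M + n) → ℝ) :
    (T.liftN n).fn z = T.fn (fun i => z (Fin.castAdd n i)) := by
  simp only [fn, liftN, aeval_rename]; rfl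

/-- `liftN (n+1) = lift ∘ liftN n`. [folklore] -/
theorem liftN_succ (T : RFun M) (n : ℕ) : T.liftN (n + 1) = (T.liftN n).lift := by
  have h : (Fin.castSucc ∘ Fin.castAdd n : Fin M → Fin (M + n + 1)) = Fin.castAdd (n + 1) := by
    funext i; apply Fin.ext; simp
  simp only [liftN, lift, rename_rename, h]

/-- `liftN 0` has the same values. [folklore] -/
theorem fn_liftN_zero (T : RFun M) (z : Fin (M + 0) → ℝ) : (T.liftN 0).fn z = T.fn z := by
  rw [fn_liftN]; rfl

/-- Substitution along polynomials mapping the cube into the cube. [folklore] -/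
def subst (T : RFun M) (σ : Fin M → MvPolynomial (Fin N) ℚ)
    (hσ : ∀ y ∈ KZ.cube N, (fun i => (aeval y (σ i) : ℝ)) ∈ KZ.cube M) : RFun N :=
  ⟨bind₁ σ T.num, bind₁ σ T.den, fun y hy => by rw [aeval_bind₁]; exact T.den_ne _ (hσ y hy)⟩

/-- Value of a substitution. [folklore] -/
theorem fn_subst (T : RFun M) (σ : Fin M → MvPolynomial (Fin N) ℚ)
    (hσ : ∀ y ∈ KZ.cube N, (fun i => (aeval y (σ i) : ℝ)) ∈ KZ.cube M) (y : Fin N → ℝ) :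
    (T.subst σ hσ).fn y = T.fn (fun i => aeval y (σ i)) := by
  simp only [fn, subst, aeval_bind₁]

end RFun

/-! ## The `χ`-integral of a regular rational function and its rules -/

section Chi

variable {R : Type} [CommRing R] (χ : KZ.FormalRep →+ R)

/-- `⟪T⟫ = χ [[0,1]^M, T]`: the `χ`-value of the cube representation. [folklore] -/
def RFun.chi (T : RFun M) : R := χ (KZ.of T.rep)

end Chi

end Literature.NumberTheory.Transcendental.KZ
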